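/-
Copyright (c) 2026 the pub-hodgecm-mathlib formalisation cell (harness21).  Prover seat hodgecm-mathlib-K2E2-p12 (g3): Track B «K2-LIT»,
#184♮ = hLiu418 = stmt-HodgeConjecture-24832; organ #33b (c0) «THE SIEGEL CHARACTER IS TRIVIAL ON `P_Δ(𝔸) ∩ K^S_H`» of the tier-1 socket module
`Cruxes/HLiu418/Lines/K2_Liu_CurveThetaSigs_U5d_ZetaS.lean` (discharges the by-value hypothesis `hδK` of ★ (c1) `K2LiuSiegelSectionRestrictedProduct`;
LEAD F0P6-plan (g11) pointer 2026-09-04T05:09:44Z, GO «either way» ibid.); 2026-09-04.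
-/
import Summits.HodgeConjecture.HodgeConjecture.Theorems.K2LiuIwasawaDeltaUnimodular            -- ★ `modDelta_eq_one_of_mem_compact_subgroup`
import Summits.HodgeConjecture.HodgeConjecture.Theorems.K2LiuIwasawaDatumAdapted                -- ★ `exists_subgroup_adapted`, `isCompact_adapted`, `eq_finAdelicToAdelic_finPart_of_archPart_eq_one`
import Summits.HodgeConjecture.HodgeConjecture.Theorems.K2LiuDoublingHeightQuasiFactorization  -- ★ `isSiegelDelta_locToAdelic_evalPlace`
import Literature.NumberTheory.GaloisRepresentations.LAdicCharacterIdelicValuesProofs           -- ★ `IdelicCharacter.map_eq_one_of_forall_valued_eq_one`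
import HarnessLib

/-!
# Crux `HLiu418`, Track B road `K2_Liu`, unit U5d «`Z_S`», organ #33b (c0):
# `δ_{χ,s₀} = 1` on `P_Δ(𝔸) ∩ K^S_H` for `χ` unramified off `S`

Cell `hodgecm-mathlib`, crux item hLiu418 = `stmt-HodgeConjecture-24832`, route of record `HCCMUnconditional`; squad K2 ∕ K2Liu.

For `q ∈ P_Δ(𝔸)` with `q_∞ = 1`, every `q_v ∈ K_{H,v}` and `q_v = 1` for `v ∈ S`:
* the MODULUS half `|det_Δ q|^{1/2} = 1` is ★ `K2LiuIwasawaDeltaUnimodular.modDelta_eq_one_of_mem_compact_subgroup` on the compact group `K^S_H`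
  (= the adapted level of the trivial subgroup, ★ `exists_subgroup_adapted` ∕ ★ `isCompact_adapted`);
* the CHARACTER half `χ(det_Δ q) = 1` is ★ `IdelicCharacter.map_eq_one_of_forall_valued_eq_one` at the idele `z = det_Δ q`: `z_∞ = 1`
  (★ `fst_detDelta_finAdelicToAdelic`), `z_w = 1` above `S`, `|z_w|_w = 1` everywhere (★ `valuation_localDetDelta_eq_one`, as `q_v ∈ P_Δ(L⁺_v) ∩ K_{H,v}`
  by ★ `isSiegelDelta_locToAdelic_evalPlace`), and `χ` is unramified at every `w ∤ S`.
Hence `siegelDeltaCharacter_eq_one_of_mem_KS`: **`δ_{χ,s₀}(q) = χ(det_Δ q)|det_Δ q|^{s₀+n/2} = 1`** — the hypothesis `hδK` of ★ (c1)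
`K2LiuSiegelSectionRestrictedProduct.isSiegelDeltaSection_restrictedProduct`, discharged from `hχ`.
[cite: Tan1999, §1] [cite: CasselsFrohlichANT1967, Ch. VII §4] [cite: GelbartRogawski1991, §3.1 (3.1.2)–(3.1.3)] [cite: MoeglinWaldspurger1995, I.2.2] [cite: BorelJacquet1979, §4.1]

HONEST LABEL: HC_CM is proved only modulo the 7 printed citations (2 remaining named inputs: hLiu418 = stmt-HodgeConjecture-24832,
h413 = stmt-HodgeConjecture-24833) until rung 0 closes; this file is a helper (`--supports stmt-HodgeConjecture-24832`) and closes no socket by itself.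
-/

set_option linter.dupNamespace false

noncomputable section

open scoped RestrictedProduct
open Filter NumberField IsDedekindDomain

namespace Summit.HodgeConjecture.HodgeConjecture.Cruxes.HLiu418.K2LiuSiegelCharacterTrivialOnKS

open Literature.NumberTheory.K2Lit.PlaceSplitting
open Literature.NumberTheory.Automorphic Literature.NumberTheory.Automorphic.UnitaryGroup Literature.NumberTheory.GaloisRepresentations
open Literature.NumberTheory.GelbartRogawski1991 Literature.NumberTheory.GelbartRogawski1991.GRConstruction
open Literature.NumberTheory.K2Lit.SiegelDoubled
open Summit.HodgeConjecture.HodgeConjecture.Cruxes.HLiu418.K2LiuIwasawaDatumAdapted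
open Summit.HodgeConjecture.HodgeConjecture.Cruxes.HLiu418.K2LiuIwasawaDeltaUnimodular (modDelta_eq_one_of_mem_compact_subgroup)
open Summit.HodgeConjecture.HodgeConjecture.Cruxes.HLiu418.K2LiuDoublingHeightQuasiFactorization (isSiegelDelta_locToAdelic_evalPlace)

variable (L : Type) [Field L] [NumberField L] [IsCMField L]
variable {N M n : ℕ} (e : Fin N × Fin M ≃ Fin n)
  (dV : Fin N → L) (hdV : ∀ i, IsCMField.complexConj L (dV i) = dV i) (hdV0 : ∀ i, dV i ≠ 0)
  (dW : Fin M → L) (hdW : ∀ i, IsCMField.complexConj L (dW i) = dW i) (hdW0 : ∀ i, dW i ≠ 0)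
  (S : Finset (HeightOneSpectrum (𝓞 (Fp L)))) (χ : HeckeCharacter L) (s₀ : ℂ)

/-- **`χ(det_Δ q) = 1` on `P_Δ(𝔸) ∩ K^S_H` for `χ` unramified off `S`** — ★ `IdelicCharacter.map_eq_one_of_forall_valued_eq_one` at the idele
`det_Δ q` (`q = (1, q_f)`, so `(det_Δ q)_∞ = 1`; `(det_Δ q)_w = det_Δ(q_w) = 1` above `S`; `|det_Δ(q_w)|_w = 1` at every `w` by ★ `valuation_localDetDelta_eq_one`).
[cite: CasselsFrohlichANT1967, Ch. VII §4] [cite: GelbartRogawski1991, §3.1 (3.1.2)–(3.1.3)] [cite: Tan1999, §1] -/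
theorem chiDet_eq_one_of_mem_KS (hχ : ∀ v, v ∉ S → ∀ w' : PlacesOver L v, χ.IsUnramifiedAt w'.1) (q : HA L e dV hdV dW hdW) (hq : IsSiegelDelta L e dV hdV dW hdW q)
    (hq1 : archPart (Fp L) L (IsCMField.complexConj L) (n + n) (hermD L e dV hdV dW hdW) q = 1) (hq2 : ∀ v, evalPlace (Fp L) L (IsCMField.complexConj L) (n + n)
        (hermD L e dV hdV dW hdW) v (finPart (Fp L) L (IsCMField.complexConj L) (n + n) (hermD L e dV hdV dW hdW) q) ∈ localInt L (IsCMField.complexConj L) (n + n)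
        (hermD L e dV hdV dW hdW) v)
    (hq3 : ∀ v ∈ S, evalPlace (Fp L) L (IsCMField.complexConj L) (n + n) (hermD L e dV hdV dW hdW) v (finPart (Fp L) L (IsCMField.complexConj L) (n + n) (hermD L e dV hdV dW hdW) q) = 1) :
    ((chiDet L e dV hdV dW hdW χ q : ℂˣ) : ℂ) = 1 := by
  classical
  have hu : IsUnit (detDelta L e dV hdV dW hdW q) := isUnit_detDelta_of_isSiegelDelta L e dV hdV dW hdW q hq
  have hbΔ : ∀ v, evalPlace (Fp L) L (IsCMField.complexConj L) (n + n) (hermD L e dV hdV dW hdW) v (finPart (Fp L) L (IsCMField.complexConj L) (n + n)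
      (hermD L e dV hdV dW hdW) q) ∈ siegelDeltaLoc L e dV hdV dW hdW v := fun v =>
    (mem_siegelDeltaLoc_iff L e dV hdV dW hdW v _).2 (isSiegelDelta_locToAdelic_evalPlace L e dV hdV dW hdW v q hq)
  have hdet : detDelta L e dV hdV dW hdW q = detDelta L e dV hdV dW hdW (finAdelicToAdelic (Fp L) L (IsCMField.complexConj L) (n + n) (hermD L e dV hdV dW hdW) (finPart (Fp L) L
      (IsCMField.complexConj L) (n + n) (hermD L e dV hdV dW hdW) q)) :=
    congrArg (detDelta L e dV hdV dW hdW) (eq_finAdelicToAdelic_finPart_of_archPart_eq_one hq1)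
  have key : χ.toContinuousMonoidHom hu.unit = 1 := by
    refine IdelicCharacter.map_eq_one_of_forall_valued_eq_one χ.toContinuousMonoidHom
      (S := {w : HeightOneSpectrum (𝓞 L) | w.under (𝓞 (Fp L)) ∈ S}) (fun w hw u => ?_) hu.unit ?_ ?_ ?_
    · exact (hχ _ hw ⟨w, rfl⟩ : χ.IsUnramifiedAt w) u
    · rw [IsUnit.unit_spec, hdet]
      exact fst_detDelta_finAdelicToAdelic L e dV hdV dW hdW _
    · intro w hw
      rw [IsUnit.unit_spec, hdet, snd_detDelta_finAdelicToAdelic_apply]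
      have h1 : GLn.evalAt (n + n) L w ((finPart (Fp L) L (IsCMField.complexConj L) (n + n) (hermD L e dV hdV dW hdW) q : finAdelic (Fp L) L (IsCMField.complexConj L) (n + n)
          (hermD L e dV hdV dW hdW)) : GL (Fin (n + n)) (FiniteAdeleRing (𝓞 L) L)) = 1 :=
        congrArg (fun u : ↥(localPi L (IsCMField.complexConj L) (n + n) (hermD L e dV hdV dW hdW) (w.under (𝓞 (Fp L)))) => ((u : LocalGLPi L (n + n) (w.under (𝓞 (Fp L)))) ⟨w, rfl⟩))
            (hq3 _ hw)
      rw [h1, Units.val_one, detDeltaM_one]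
    · intro w
      rw [IsUnit.unit_spec, hdet, snd_detDelta_finAdelicToAdelic_apply]
      have h := valuation_localDetDelta_eq_one L e dV hdV dW hdW (w.under (𝓞 (Fp L))) (hbΔ _) (hq2 _) ⟨w, rfl⟩
      rw [UnitaryDualPair.LocalSplitting.valuation_eq_one_iff_valued, localDetDelta_eq_detDeltaM] at h
      exact h
  rw [chiDet, dif_pos hu]
  exact congrArg Units.val key

include hdV0 hdW0 in
/-- **the modulus `|det_Δ q|^{1/2} = 1` on `P_Δ(𝔸) ∩ K^S_H`**: `K^S_H` is a compact subgroup (the adapted level of `{1}`, ★ `exists_subgroup_adapted` ∕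
★ `isCompact_adapted`) and ★ `modDelta_eq_one_of_mem_compact_subgroup`. [cite: MoeglinWaldspurger1995, I.2.2] [cite: BorelJacquet1979, §4.1] -/
theorem modDelta_eq_one_of_mem_KS (q : HA L e dV hdV dW hdW) (hq : IsSiegelDelta L e dV hdV dW hdW q)
    (hq1 : archPart (Fp L) L (IsCMField.complexConj L) (n + n) (hermD L e dV hdV dW hdW) q = 1) (hq2 : ∀ v, evalPlace (Fp L) L (IsCMField.complexConj L) (n + n)
        (hermD L e dV hdV dW hdW) v (finPart (Fp L) L (IsCMField.complexConj L) (n + n) (hermD L e dV hdV dW hdW) q) ∈ localInt L (IsCMField.complexConj L) (n + n)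
        (hermD L e dV hdV dW hdW) v)
    (hq3 : ∀ v ∈ S, evalPlace (Fp L) L (IsCMField.complexConj L) (n + n) (hermD L e dV hdV dW hdW) v (finPart (Fp L) L (IsCMField.complexConj L) (n + n) (hermD L e dV hdV dW hdW) q) = 1) :
    modDelta L e dV hdV dW hdW q = 1 := by
  obtain ⟨K, hK⟩ := exists_subgroup_adapted L e dV hdV dW hdW (⊥ : Subgroup (HA L e dV hdV dW hdW)) S
  have hKc : IsCompact (K : Set (HA L e dV hdV dW hdW)) :=
    isCompact_adapted L e dV hdV dW hdW (by rw [Subgroup.coe_bot]; exact isCompact_singleton) S hK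
  have hqK : q ∈ K :=
    (hK q).2 ⟨⟨1, (⊥ : Subgroup (HA L e dV hdV dW hdW)).one_mem, by rw [archPart_one', hq1], fun v => by rw [finPart_one', map_one, hq3 v.1 v.2]⟩, fun v _ => hq2 v⟩
  exact modDelta_eq_one_of_mem_compact_subgroup L e dV hdV hdV0 dW hdW hdW0 K hKc hqK hq

include hdV0 hdW0 in
/-- **THE SIEGEL CHARACTER IS TRIVIAL ON `P_Δ(𝔸) ∩ K^S_H`** (#33b (c0)): for `χ` unramified at every place above `v ∉ S` and `q ∈ P_Δ(𝔸)` with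
`q_∞ = 1`, all `q_v ∈ K_{H,v}` and `q_v = 1` (`v ∈ S`): `δ_{χ,s₀}(q) = χ(det_Δ q)·|det_Δ q|^{s₀+n/2} = 1` — exactly the hypothesis `hδK` of ★ (c1)
`K2LiuSiegelSectionRestrictedProduct.isSiegelDeltaSection_restrictedProduct`. [cite: Tan1999, §1] [cite: CasselsFrohlichANT1967, Ch. VII §4] [cite: GelbartRogawski1991, §3.1
    (3.1.2)–(3.1.3)] -/
theorem siegelDeltaCharacter_eq_one_of_mem_KS (hχ : ∀ v, v ∉ S → ∀ w' : PlacesOver L v, χ.IsUnramifiedAt w'.1) (q : HA L e dV hdV dW hdW) (hq : IsSiegelDelta L e dV hdV dW hdW q)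
    (hq1 : archPart (Fp L) L (IsCMField.complexConj L) (n + n) (hermD L e dV hdV dW hdW) q = 1) (hq2 : ∀ v, evalPlace (Fp L) L (IsCMField.complexConj L) (n + n)
        (hermD L e dV hdV dW hdW) v (finPart (Fp L) L (IsCMField.complexConj L) (n + n) (hermD L e dV hdV dW hdW) q) ∈ localInt L (IsCMField.complexConj L) (n + n)
        (hermD L e dV hdV dW hdW) v)
    (hq3 : ∀ v ∈ S, evalPlace (Fp L) L (IsCMField.complexConj L) (n + n) (hermD L e dV hdV dW hdW) v (finPart (Fp L) L (IsCMField.complexConj L) (n + n) (hermD L e dV hdV dW hdW) q) = 1) :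
    siegelDeltaCharacter L e dV hdV dW hdW χ s₀ q = 1 := by
  rw [siegelDeltaCharacter, chiDet_eq_one_of_mem_KS L e dV hdV dW hdW S χ hχ q hq hq1 hq2 hq3,
    modDelta_eq_one_of_mem_KS L e dV hdV hdV0 dW hdW hdW0 S q hq hq1 hq2 hq3, Complex.ofReal_one, Complex.one_cpow, mul_one]

include hdV0 hdW0 in
/-- the same, in the binder shape of ★ (c1)'s `hδK`. [cite: Tan1999, §1] -/
theorem siegelDeltaCharacter_trivial_on_KS (hχ : ∀ v, v ∉ S → ∀ w' : PlacesOver L v, χ.IsUnramifiedAt w'.1) :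
    ∀ q : HA L e dV hdV dW hdW, IsSiegelDelta L e dV hdV dW hdW q → archPart (Fp L) L (IsCMField.complexConj L) (n + n) (hermD L e dV hdV dW hdW) q = 1 → (∀ v, evalPlace (Fp L) L
        (IsCMField.complexConj L) (n + n) (hermD L e dV hdV dW hdW) v (finPart (Fp L) L (IsCMField.complexConj L) (n + n) (hermD L e dV hdV dW hdW) q) ∈ localInt L
        (IsCMField.complexConj L) (n + n) (hermD L e dV hdV dW hdW) v) →
      (∀ v ∈ S, evalPlace (Fp L) L (IsCMField.complexConj L) (n + n) (hermD L e dV hdV dW hdW) v (finPart (Fp L) L (IsCMField.complexConj L) (n + n)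
          (hermD L e dV hdV dW hdW) q) = 1) → siegelDeltaCharacter L e dV hdV dW hdW χ s₀ q = 1 :=
  fun q hq hq1 hq2 hq3 => siegelDeltaCharacter_eq_one_of_mem_KS L e dV hdV hdV0 dW hdW hdW0 S χ s₀ hχ q hq hq1 hq2 hq3

end Summit.HodgeConjecture.HodgeConjecture.Cruxes.HLiu418.K2LiuSiegelCharacterTrivialOnKS

end
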